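import Summits.HodgeConjecture.HodgeConjecture.Theorems.MarkmanPartnerTransportPicardThreeK3SquaresAlgebraicLocusSpread
import Literature.AlgebraicGeometry.HodgeTheory.InvariantClassesFromTotalSpaceProofs
import Literature.AlgebraicGeometry.HodgeTheory.InvariantClassesFromTotalSpaceHolds
import Literature.AlgebraicGeometry.HodgeTheory.DirectImageCovering

/-!
# Route MarkmanPartnerTransport · crux `PicardThreeK3Squares` (stmt-HodgeConjecture-19652) —
# the spread of algebraicity for FLAT SECTIONS, and the flat-section form of the spread-family
# reduction of the real-multiplication third

Companion of `…AlgebraicLocusSpread` (stub F3 of line `cm-anchor-spread`, proved there for GLOBAL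
classes `W ∈ H²ᵖ(𝒳(ℂ); ℂ)`). On the real-multiplication Noether–Lefschetz family through a K3 square the
generator class `t_e` is born as a FLAT SECTION of `R⁴ g_* ℂ` (monodromy-invariant after a finite base
change), not as a class of the total space; the passage "flat section ⟹ restriction of a global class"
is Deligne's theorem of the fixed part (Voisin II Thm. 4.18; the tree's NAMED FACT
`deligne1968_invariantClass_fromTotalSpace`, `ℂ`-coefficients, pointwise). This file makes that passage
once and for all, so that a variational line on the crux needs from moduli theory ONLY the family and
the flatness of the generator:

* `section_eq_globalSection_of_eq` — UNIQUENESS OF FLAT CONTINUATION on the real carriers: over a smooth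
  irreducible quasi-projective base, a continuous section `σ` of the espace étalé `FiberClass g k` of
  `Rᵏ g_* ℂ` which agrees with the global section of a class `β` at ONE point agrees with it everywhere
  (`Rᵏ g_* ℂ` is a covering space of the connected `B(ℂ)`, `isCoveringMap_projOver`; uniqueness of lifts);
* `forall_cls_mem_algebraicClasses_of_isOpen_of_section` / `…_of_denseRange_of_section` — granted the
  named fact, a continuous section whose values are algebraic on a non-empty open set (resp. over the
  image of a dominant morphism from an irreducible scheme) has algebraic values everywhere;
* `hodgeConjectureFor_square_of_spreadFamily_of_section` / `…_of_dominantFamily_of_section` — the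
  F3∘F4 reduction of `…AlgebraicLocusSpread` with the global class replaced by a flat section: for a
  smooth projective surface `S` with `t` rational, killing `N¹`, generating the rational Hodge
  endomorphisms of `T(S)`, if `S ⊗ S` is a fibre of a smooth projective family over a smooth irreducible
  quasi-projective base carrying a continuous section `σ` of `R⁴` whose value at that fibre induces `t`
  and whose values are algebraic over a non-empty open set (resp. a dominant family), then the Hodge
  conjecture holds for `S ⊗ S` — CONDITIONAL on `deligne1968_invariantClass_fromTotalSpace` only.

No definition, no sorry; one named fact as an explicit hypothesis. Prover seat hodge-nonav-19652-p1
(gen 7), `--supports stmt-HodgeConjecture-19652`. Nothing here proves the crux or the Hodge conjecture.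

References: Voisin, *Hodge Theory II* (2003), Thm. 4.18, §5.3.1, §7.3.2; Deligne 1968 Prop. (2.1);
Voisin, *Hodge Theory I* (2002), §9.2.1; Charles–Schnell (2014), Prop. 11.3.11.
-/

set_option linter.dupNamespace false

noncomputable section

namespace Summit.HodgeConjecture.HodgeConjecture.Theorems.MarkmanPartnerTransport.AlgebraicLocusSpread

open CategoryTheory MonoidalCategory CartesianMonoidalCategory AlgebraicGeometry
open Literature.AlgebraicGeometry Literature.AlgebraicGeometry.Motives Literature.AlgebraicGeometry.HodgeTheory
open Literature.AlgebraicGeometry.Surfaces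
open Literature.AlgebraicTopology.SingularHomology

variable {𝒳 B : SchemeOver ℂ}

/-! ### Uniqueness of flat continuation -/

/-- **Two flat sections agreeing at a point agree everywhere.** For a smooth projective family
`g : 𝒳 → B` over a smooth IRREDUCIBLE quasi-projective base, a continuous section `σ` of the espace
étalé of `Rᵏ g_* ℂ` (`FiberClass g k`, `(σ b).pt = b`) and a global class `β ∈ Hᵏ(𝒳(ℂ); ℂ)` with
`σ b₀ = (b₀, β|_{𝒳_{b₀}})`: then `σ b = (b, β|_{𝒳_b})` for every `b`. Indeed `Rᵏ g_* ℂ` is a local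
system on all of `B(ℂ)` (`isCohomologicallyLocallyTrivialOn_univ_of_isQuasiProjectiveOver`: Ehresmann
+ homotopy invariance), its espace étalé is a covering space (`isCoveringMap_projOver`), `B(ℂ)` is
connected (`B` irreducible, SGA1 XII 2.4), and two lifts of the identity agreeing at a point agree
(Mathlib `IsCoveringMap.eq_of_comp_eq`). [cite: VoisinHodgeI2002, §9.2.1]
[cite: SGA1, Exp. XII Prop. 2.4] -/
theorem section_eq_globalSection_of_eq (g : 𝒳 ⟶ B) {n : ℕ} (k : ℕ)
    (hg : IsSmoothProjectiveFamily g n) (hB : IsQuasiProjectiveOver B)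
    (hBsm : AlgebraicGeometry.Smooth B.hom) [IrreducibleSpace B.left]
    (σ : ComplexPoints B → FiberClass g k) (hσ : Continuous σ) (hpt : ∀ b, (σ b).pt = b)
    (β : complexBetti 𝒳 k) {b₀ : ComplexPoints B} (h₀ : σ b₀ = globalSection g k β b₀)
    (b : ComplexPoints B) : σ b = globalSection g k β b := by
  have hU := isCohomologicallyLocallyTrivialOn_univ_of_isQuasiProjectiveOver g hg hB hBsm
  have hcov := isCoveringMap_projOver (π := g) (k := k) hU
  haveI : LocallyOfFiniteType B.hom := locallyOfFiniteType_of_isQuasiProjectiveOver hB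
  haveI : ConnectedSpace (ComplexPoints B) :=
    (ComplexPoints.connectedSpace_iff_holds B).2 inferInstance
  -- the two sections as lifts of `b ↦ ⟨b, trivial⟩ : B(ℂ) → univ`
  let s₁ : ComplexPoints B → fiberClassesOver g k Set.univ := fun b => ⟨σ b, Set.mem_univ _⟩
  let s₂ : ComplexPoints B → fiberClassesOver g k Set.univ :=
    fun b => ⟨globalSection g k β b, Set.mem_univ _⟩
  have hs₁ : Continuous s₁ := hσ.subtype_mk _
  have hs₂ : Continuous s₂ := (continuous_globalSection g k β).subtype_mk _
  have hcomp : projOver g k Set.univ ∘ s₁ = projOver g k Set.univ ∘ s₂ := by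
    funext b
    apply Subtype.ext
    change (σ b).pt = (globalSection g k β b).pt
    rw [hpt, pt_globalSection]
  have heq := hcov.eq_of_comp_eq hs₁ hs₂ hcomp b₀ (Subtype.ext h₀)
  have := congrArg (fun s => (s b : fiberClassesOver g k Set.univ).1) heq
  exact this

/-- Consequently the VALUES of such a section are the fibre restrictions of `β`:
`(σ b).cls = β|_{𝒳_b}` (transport of the class along `σ b = (b, β|_{𝒳_b})`).
[cite: VoisinHodgeI2002, §9.2.1] -/
theorem cls_eq_map_of_section_eq_globalSection (g : 𝒳 ⟶ B) (k : ℕ)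
    (σ : ComplexPoints B → FiberClass g k) (β : complexBetti 𝒳 k) {b : ComplexPoints B}
    (hpt : (σ b).pt = b) (h : σ b = globalSection g k β b) :
    (σ b).clsAt hpt = complexBetti.map (fiberι g b) k β := by
  rw [FiberClass.clsAt_eq_iff]
  rw [h]
  rfl

/-! ### Spread of algebraicity for flat sections (modulo Voisin II Thm. 4.18) -/

/-- **A flat section algebraic on a non-empty open set is algebraic everywhere** (granted Deligne's
theorem of the fixed part, Voisin II Thm. 4.18 = the named fact `deligne1968_invariantClass_fromTotalSpace`).
Setting: `g : 𝒳 → B` smooth projective family, `𝒳`, `B` quasi-projective, `B` smooth irreducible;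
`σ` a continuous section of `FiberClass g (2p)`. If `(σ b).cls` is algebraic for all `b` in a non-empty
open `U ⊆ B(ℂ)`, it is algebraic for all `b`: the fact gives `β ∈ H²ᵖ(𝒳(ℂ); ℂ)` with `σ b₁ = (b₁, β|_{b₁})`,
uniqueness of continuation (`section_eq_globalSection_of_eq`) gives `σ = (·, β|_·)` everywhere, and the
global-class spread `forall_mem_algebraicClasses_of_isOpen` applies to `β`.
[cite: VoisinHodgeII2003, Thm. 4.18 and §7.3.2] [cite: CharlesSchnell2014Notes, Prop. 11.3.11] -/
theorem forall_cls_mem_algebraicClasses_of_isOpen_of_section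
    (hD : deligne1968_invariantClass_fromTotalSpace) (g : 𝒳 ⟶ B) {n p : ℕ}
    (hg : IsSmoothProjectiveFamily g n) (h𝒳 : IsQuasiProjectiveOver 𝒳) (hB : IsQuasiProjectiveOver B)
    (hBsm : AlgebraicGeometry.Smooth B.hom) [IrreducibleSpace B.left]
    (σ : ComplexPoints B → FiberClass g (2 * p)) (hσ : Continuous σ) (hpt : ∀ b, (σ b).pt = b)
    {U : Set (ComplexPoints B)} (hU : IsOpen U) (hUne : U.Nonempty)
    (hUalg : ∀ b ∈ U, (σ b).clsAt (hpt b) ∈ algebraicClasses (fiberOver g b) p)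
    (b : ComplexPoints B) :
    (σ b).clsAt (hpt b) ∈ algebraicClasses (fiberOver g b) p := by
  obtain ⟨β, hβ⟩ := hD 𝒳 B g n hg h𝒳 hB hBsm (2 * p) σ hσ hpt b
  have hall : ∀ b', σ b' = globalSection g (2 * p) β b' :=
    section_eq_globalSection_of_eq g (2 * p) hg hB hBsm σ hσ hpt β hβ
  have hcls : ∀ b', (σ b').clsAt (hpt b') = complexBetti.map (fiberι g b') (2 * p) β := fun b' =>
    cls_eq_map_of_section_eq_globalSection g (2 * p) σ β (hpt b') (hall b')
  rw [hcls]
  exact forall_mem_algebraicClasses_of_isOpen g hg h𝒳 hB hBsm β hU hUne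
    (fun b' hb' => (hcls b') ▸ hUalg b' hb') b

/-- **A flat section algebraic along a dominant family is algebraic everywhere** (granted Voisin II
Thm. 4.18): as `forall_cls_mem_algebraicClasses_of_isOpen_of_section`, with the open set replaced by a
dominant morphism `c : V → B` from an irreducible separated `V` locally of finite type such that
`(σ (c v)).cls` is algebraic for every `v ∈ V(ℂ)` (`forall_mem_algebraicClasses_of_denseRange`).
[cite: VoisinHodgeII2003, Thm. 4.18 and §7.3.2] [cite: CharlesSchnell2014Notes, Prop. 11.3.11] -/
theorem forall_cls_mem_algebraicClasses_of_denseRange_of_section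
    (hD : deligne1968_invariantClass_fromTotalSpace) (g : 𝒳 ⟶ B) {n p : ℕ}
    (hg : IsSmoothProjectiveFamily g n) (h𝒳 : IsQuasiProjectiveOver 𝒳) (hB : IsQuasiProjectiveOver B)
    (hBsm : AlgebraicGeometry.Smooth B.hom) [IrreducibleSpace B.left]
    (σ : ComplexPoints B → FiberClass g (2 * p)) (hσ : Continuous σ) (hpt : ∀ b, (σ b).pt = b)
    {V : SchemeOver ℂ} (c : V ⟶ B) [IrreducibleSpace V.left] [IsSeparated V.hom]
    [LocallyOfFiniteType V.hom] [Nonempty (ComplexPoints V)] (hc : DenseRange c.left.base)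
    (hValg : ∀ v : ComplexPoints V,
      (σ (AlgPoints.map c v)).clsAt (hpt _) ∈ algebraicClasses (fiberOver g (AlgPoints.map c v)) p)
    (b : ComplexPoints B) :
    (σ b).clsAt (hpt b) ∈ algebraicClasses (fiberOver g b) p := by
  obtain ⟨β, hβ⟩ := hD 𝒳 B g n hg h𝒳 hB hBsm (2 * p) σ hσ hpt b
  have hall : ∀ b', σ b' = globalSection g (2 * p) β b' :=
    section_eq_globalSection_of_eq g (2 * p) hg hB hBsm σ hσ hpt β hβ
  have hcls : ∀ b', (σ b').clsAt (hpt b') = complexBetti.map (fiberι g b') (2 * p) β := fun b' =>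
    cls_eq_map_of_section_eq_globalSection g (2 * p) σ β (hpt b') (hall b')
  rw [hcls]
  exact forall_mem_algebraicClasses_of_denseRange g hg h𝒳 hB hBsm β c hc
    (fun v => (hcls _) ▸ hValg v) b

/-! ### The flat-section form of the spread-family reduction (F3 ∘ F4) -/

variable {S : SchemeOver ℂ}

/-- `Corr[hS ; γ, y] = pr₁_*(pr₂^* y ∪ γ)` on `H²(S(ℂ); ℂ)` for the complex orientation family (as in
`…AlgebraicLocusSpread` and `SquareOfGenerator.squareOfGenerator`). Local notation only. -/
local notation3 (prettyPrint := false) "Corr[" hS " ; " γ ", " y "]" =>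
  complexGysin complexOrientationFamily (IsSmoothProjective.tensor_holds hS hS) hS
    (SemiCartesianMonoidalCategory.fst _ _) (rfl : 2 * 1 + 2 * 2 + 2 * 2 = 2 * 1 + 2 * (2 + 2))
    (cupProduct (rfl : 2 * 1 + 2 * 2 = 2 * 1 + 2 * 2)
      (complexBetti.map (SemiCartesianMonoidalCategory.snd _ _) (2 * 1) y) γ)

/-- **Spread-family reduction, flat-section form (open set).** Let `S` be a smooth projective surface,
`t` a rational endomorphism of `H²(S(ℂ); ℂ)` killing `N¹` with `TranscendentalEndomorphismsGeneratedBy S t`.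
Suppose `e₁ : S ⊗ S ≅ 𝒳_{b₁}` is a fibre of a smooth projective family `g : 𝒳 → B` (`𝒳`, `B`
quasi-projective; `B` smooth irreducible) carrying a CONTINUOUS SECTION `σ` of `FiberClass g 4` — a flat
section of `R⁴ g_* ℂ`, e.g. a monodromy-invariant class — whose value at `b₁`, pulled back along `e₁`,
induces `t`, and whose values are algebraic for `b` in a non-empty open `U ⊆ B(ℂ)`. Then, granted
Voisin II Thm. 4.18 (`deligne1968_invariantClass_fromTotalSpace`), the Hodge conjecture holds for
`S ⊗ S`: `σ`'s value at `b₁` is algebraic (`forall_cls_mem_algebraicClasses_of_isOpen_of_section`), so `t`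
is cycle-induced, and F4 `SquareOfGenerator.squareOfGenerator` concludes.
[cite: VoisinHodgeII2003, Thm. 4.18 and §7.3.2] [cite: Varesco2023, §2 (p. 8)]
[cite: GeemenSchutt2023, §3 and §4.8] -/
theorem hodgeConjectureFor_square_of_spreadFamily_of_section
    (hD : deligne1968_invariantClass_fromTotalSpace) (hS : IsSmoothProjective 2 S)
    (t : complexBetti S (2 * 1) →ₗ[ℂ] complexBetti S (2 * 1))
    (ht_rat : ∀ y, IsRationalClass y → IsRationalClass (t y))
    (ht_N : ∀ d ∈ algebraicClasses S 1, t d = 0)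
    (hgen : TranscendentalEndomorphismsGeneratedBy S t)
    (g : 𝒳 ⟶ B) {n : ℕ} (hg : IsSmoothProjectiveFamily g n) (h𝒳 : IsQuasiProjectiveOver 𝒳)
    (hB : IsQuasiProjectiveOver B) (hBsm : AlgebraicGeometry.Smooth B.hom) [IrreducibleSpace B.left]
    (σ : ComplexPoints B → FiberClass g (2 * 2)) (hσ : Continuous σ) (hpt : ∀ b, (σ b).pt = b)
    {U : Set (ComplexPoints B)} (hU : IsOpen U) (hUne : U.Nonempty)
    (hUalg : ∀ b ∈ U, (σ b).clsAt (hpt b) ∈ algebraicClasses (fiberOver g b) 2)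
    (b₁ : ComplexPoints B) (e₁ : S ⊗ S ≅ fiberOver g b₁)
    (ht : ∀ y : complexBetti S (2 * 1),
      t y = Corr[hS ; complexBetti.map e₁.hom (2 * 2) ((σ b₁).clsAt (hpt b₁)), y]) :
    HodgeConjectureFor 4 (S ⊗ S) :=
  SquareOfGenerator.squareOfGenerator S hS t ht_rat ht_N
    ⟨complexBetti.map e₁.hom (2 * 2) ((σ b₁).clsAt (hpt b₁)),
      map_mem_algebraicClasses_of_isIso e₁.hom
        (forall_cls_mem_algebraicClasses_of_isOpen_of_section hD g hg h𝒳 hB hBsm σ hσ hpt hU hUne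
          hUalg b₁), ht⟩ hgen

/-- **Spread-family reduction, flat-section form (dominant family).** As
`hodgeConjectureFor_square_of_spreadFamily_of_section`, with algebraicity of the values of `σ` assumed
over the image of a DOMINANT morphism `c : V → B` from an irreducible separated `V` locally of finite
type (`forall_cls_mem_algebraicClasses_of_denseRange_of_section`) — the shape delivered by an algebraic
family of surfaces each carrying the generator as a cycle and dominating the real-multiplication locus
(van Geemen–Schütt's maximal families). Conditional on `deligne1968_invariantClass_fromTotalSpace` only.
[cite: VoisinHodgeII2003, Thm. 4.18 and §7.3.2] [cite: GeemenSchutt2023, §3, Thm. 1.1 (9) and §4.8]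
[cite: Varesco2023, §2 (p. 8)] -/
theorem hodgeConjectureFor_square_of_dominantFamily_of_section
    (hD : deligne1968_invariantClass_fromTotalSpace) (hS : IsSmoothProjective 2 S)
    (t : complexBetti S (2 * 1) →ₗ[ℂ] complexBetti S (2 * 1))
    (ht_rat : ∀ y, IsRationalClass y → IsRationalClass (t y))
    (ht_N : ∀ d ∈ algebraicClasses S 1, t d = 0)
    (hgen : TranscendentalEndomorphismsGeneratedBy S t)
    (g : 𝒳 ⟶ B) {n : ℕ} (hg : IsSmoothProjectiveFamily g n) (h𝒳 : IsQuasiProjectiveOver 𝒳)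
    (hB : IsQuasiProjectiveOver B) (hBsm : AlgebraicGeometry.Smooth B.hom) [IrreducibleSpace B.left]
    (σ : ComplexPoints B → FiberClass g (2 * 2)) (hσ : Continuous σ) (hpt : ∀ b, (σ b).pt = b)
    {V : SchemeOver ℂ} (c : V ⟶ B) [IrreducibleSpace V.left] [IsSeparated V.hom]
    [LocallyOfFiniteType V.hom] [Nonempty (ComplexPoints V)] (hc : DenseRange c.left.base)
    (hValg : ∀ v : ComplexPoints V,
      (σ (AlgPoints.map c v)).clsAt (hpt _) ∈ algebraicClasses (fiberOver g (AlgPoints.map c v)) 2)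
    (b₁ : ComplexPoints B) (e₁ : S ⊗ S ≅ fiberOver g b₁)
    (ht : ∀ y : complexBetti S (2 * 1),
      t y = Corr[hS ; complexBetti.map e₁.hom (2 * 2) ((σ b₁).clsAt (hpt b₁)), y]) :
    HodgeConjectureFor 4 (S ⊗ S) :=
  SquareOfGenerator.squareOfGenerator S hS t ht_rat ht_N
    ⟨complexBetti.map e₁.hom (2 * 2) ((σ b₁).clsAt (hpt b₁)),
      map_mem_algebraicClasses_of_isIso e₁.hom
        (forall_cls_mem_algebraicClasses_of_denseRange_of_section hD g hg h𝒳 hB hBsm σ hσ hpt c hc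
          hValg b₁), ht⟩ hgen


/-! ### Unconditional forms (appended): Voisin II Thm. 4.18 is a theorem of the tree

The named fact `deligne1968_invariantClass_fromTotalSpace` consumed above is DISCHARGED in the tree
(`deligne1968_invariantClass_fromTotalSpace_holds`, `InvariantClassesFromTotalSpaceHolds.lean`; referee
hodge-nonav-ref g57, note n-S1). The four statements above therefore hold outright; the primed versions
below instantiate them, so that no consumer of the flat-section spread carries a phantom hypothesis. -/

/-- **A flat section algebraic on a non-empty open set is algebraic everywhere — UNCONDITIONAL**
(`forall_cls_mem_algebraicClasses_of_isOpen_of_section` with Voisin II Thm. 4.18 supplied by the tree's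
`deligne1968_invariantClass_fromTotalSpace_holds`). [cite: VoisinHodgeII2003, Thm. 4.18 and §7.3.2]
[cite: CharlesSchnell2014Notes, Prop. 11.3.11] -/
theorem forall_cls_mem_algebraicClasses_of_isOpen_of_section' (g : 𝒳 ⟶ B) {n p : ℕ}
    (hg : IsSmoothProjectiveFamily g n) (h𝒳 : IsQuasiProjectiveOver 𝒳) (hB : IsQuasiProjectiveOver B)
    (hBsm : AlgebraicGeometry.Smooth B.hom) [IrreducibleSpace B.left]
    (σ : ComplexPoints B → FiberClass g (2 * p)) (hσ : Continuous σ) (hpt : ∀ b, (σ b).pt = b)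
    {U : Set (ComplexPoints B)} (hU : IsOpen U) (hUne : U.Nonempty)
    (hUalg : ∀ b ∈ U, (σ b).clsAt (hpt b) ∈ algebraicClasses (fiberOver g b) p)
    (b : ComplexPoints B) :
    (σ b).clsAt (hpt b) ∈ algebraicClasses (fiberOver g b) p :=
  forall_cls_mem_algebraicClasses_of_isOpen_of_section deligne1968_invariantClass_fromTotalSpace_holds g
    hg h𝒳 hB hBsm σ hσ hpt hU hUne hUalg b

/-- **A flat section algebraic along a dominant family is algebraic everywhere — UNCONDITIONAL**
(`forall_cls_mem_algebraicClasses_of_denseRange_of_section` with the tree's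
`deligne1968_invariantClass_fromTotalSpace_holds`). [cite: VoisinHodgeII2003, Thm. 4.18 and §7.3.2]
[cite: CharlesSchnell2014Notes, Prop. 11.3.11] -/
theorem forall_cls_mem_algebraicClasses_of_denseRange_of_section' (g : 𝒳 ⟶ B) {n p : ℕ}
    (hg : IsSmoothProjectiveFamily g n) (h𝒳 : IsQuasiProjectiveOver 𝒳) (hB : IsQuasiProjectiveOver B)
    (hBsm : AlgebraicGeometry.Smooth B.hom) [IrreducibleSpace B.left]
    (σ : ComplexPoints B → FiberClass g (2 * p)) (hσ : Continuous σ) (hpt : ∀ b, (σ b).pt = b)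
    {V : SchemeOver ℂ} (c : V ⟶ B) [IrreducibleSpace V.left] [IsSeparated V.hom]
    [LocallyOfFiniteType V.hom] [Nonempty (ComplexPoints V)] (hc : DenseRange c.left.base)
    (hValg : ∀ v : ComplexPoints V,
      (σ (AlgPoints.map c v)).clsAt (hpt _) ∈ algebraicClasses (fiberOver g (AlgPoints.map c v)) p)
    (b : ComplexPoints B) :
    (σ b).clsAt (hpt b) ∈ algebraicClasses (fiberOver g b) p :=
  forall_cls_mem_algebraicClasses_of_denseRange_of_section deligne1968_invariantClass_fromTotalSpace_holds g
    hg h𝒳 hB hBsm σ hσ hpt c hc hValg b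

/-- **Spread-family reduction, flat-section form (open set) — UNCONDITIONAL**: for a smooth projective
surface `S` and `t` rational, killing `N¹H²(S)`, with `TranscendentalEndomorphismsGeneratedBy S t`, a smooth
projective family through `S ⊗ S` over a smooth irreducible quasi-projective base carrying a flat section
of `R⁴` inducing `t` at that fibre and algebraic over a non-empty open set gives `HodgeConjectureFor 4 (S ⊗ S)`
(no named fact: Voisin II Thm. 4.18 is the tree's `deligne1968_invariantClass_fromTotalSpace_holds`).
[cite: VoisinHodgeII2003, Thm. 4.18 and §7.3.2] [cite: Varesco2023, §2 (p. 8)] -/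
theorem hodgeConjectureFor_square_of_spreadFamily_of_section' (hS : IsSmoothProjective 2 S)
    (t : complexBetti S (2 * 1) →ₗ[ℂ] complexBetti S (2 * 1))
    (ht_rat : ∀ y, IsRationalClass y → IsRationalClass (t y))
    (ht_N : ∀ d ∈ algebraicClasses S 1, t d = 0)
    (hgen : TranscendentalEndomorphismsGeneratedBy S t)
    (g : 𝒳 ⟶ B) {n : ℕ} (hg : IsSmoothProjectiveFamily g n) (h𝒳 : IsQuasiProjectiveOver 𝒳)
    (hB : IsQuasiProjectiveOver B) (hBsm : AlgebraicGeometry.Smooth B.hom) [IrreducibleSpace B.left]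
    (σ : ComplexPoints B → FiberClass g (2 * 2)) (hσ : Continuous σ) (hpt : ∀ b, (σ b).pt = b)
    {U : Set (ComplexPoints B)} (hU : IsOpen U) (hUne : U.Nonempty)
    (hUalg : ∀ b ∈ U, (σ b).clsAt (hpt b) ∈ algebraicClasses (fiberOver g b) 2)
    (b₁ : ComplexPoints B) (e₁ : S ⊗ S ≅ fiberOver g b₁)
    (ht : ∀ y : complexBetti S (2 * 1),
      t y = Corr[hS ; complexBetti.map e₁.hom (2 * 2) ((σ b₁).clsAt (hpt b₁)), y]) :
    HodgeConjectureFor 4 (S ⊗ S) :=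
  hodgeConjectureFor_square_of_spreadFamily_of_section deligne1968_invariantClass_fromTotalSpace_holds hS t
    ht_rat ht_N hgen g hg h𝒳 hB hBsm σ hσ hpt hU hUne hUalg b₁ e₁ ht

/-- **Spread-family reduction, flat-section form (dominant family) — UNCONDITIONAL**: as
`hodgeConjectureFor_square_of_dominantFamily_of_section`, with Voisin II Thm. 4.18 supplied by the tree's
`deligne1968_invariantClass_fromTotalSpace_holds`; the remaining hypotheses are exactly the geometric inputs
(I1′) a family through `S ⊗ S` with the generator as a flat section and (I2) a dominant family over which it
is algebraic. [cite: VoisinHodgeII2003, Thm. 4.18 and §7.3.2] [cite: GeemenSchutt2023, §3, Thm. 1.1 (9) and §4.8]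
[cite: Varesco2023, §2 (p. 8)] -/
theorem hodgeConjectureFor_square_of_dominantFamily_of_section' (hS : IsSmoothProjective 2 S)
    (t : complexBetti S (2 * 1) →ₗ[ℂ] complexBetti S (2 * 1))
    (ht_rat : ∀ y, IsRationalClass y → IsRationalClass (t y))
    (ht_N : ∀ d ∈ algebraicClasses S 1, t d = 0)
    (hgen : TranscendentalEndomorphismsGeneratedBy S t)
    (g : 𝒳 ⟶ B) {n : ℕ} (hg : IsSmoothProjectiveFamily g n) (h𝒳 : IsQuasiProjectiveOver 𝒳)
    (hB : IsQuasiProjectiveOver B) (hBsm : AlgebraicGeometry.Smooth B.hom) [IrreducibleSpace B.left]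
    (σ : ComplexPoints B → FiberClass g (2 * 2)) (hσ : Continuous σ) (hpt : ∀ b, (σ b).pt = b)
    {V : SchemeOver ℂ} (c : V ⟶ B) [IrreducibleSpace V.left] [IsSeparated V.hom]
    [LocallyOfFiniteType V.hom] [Nonempty (ComplexPoints V)] (hc : DenseRange c.left.base)
    (hValg : ∀ v : ComplexPoints V,
      (σ (AlgPoints.map c v)).clsAt (hpt _) ∈ algebraicClasses (fiberOver g (AlgPoints.map c v)) 2)
    (b₁ : ComplexPoints B) (e₁ : S ⊗ S ≅ fiberOver g b₁)
    (ht : ∀ y : complexBetti S (2 * 1),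
      t y = Corr[hS ; complexBetti.map e₁.hom (2 * 2) ((σ b₁).clsAt (hpt b₁)), y]) :
    HodgeConjectureFor 4 (S ⊗ S) :=
  hodgeConjectureFor_square_of_dominantFamily_of_section deligne1968_invariantClass_fromTotalSpace_holds hS t
    ht_rat ht_N hgen g hg h𝒳 hB hBsm σ hσ hpt c hc hValg b₁ e₁ ht

end Summit.HodgeConjecture.HodgeConjecture.Theorems.MarkmanPartnerTransport.AlgebraicLocusSpread
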